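import Summits.ABC.IUTFork.Cor312StatementBridge
import Summits.ABC.IUTFork.Cor312LogKummerRoute
import Summits.ABC.IUTFork.Thm311MultiradProofs
import HarnessLib

/-!
# [IUTchIII] Corollary 3.12 — bridge hypotheses from generator-level (Ind1)/(Ind2) invariance (TEAM B, B-2)

Record-only file (D-0012) of the abc-iut cell (Cor. 3.12 strategy TEAM B «estimate / log-Kummer» of HUMAN
RULING D-0067 (3), row B-2 of `HOME/plan/C312-TEAMS.md`, seat abc-iut-c312-11 pending B2's arrival); TAKES
NO SIDE. Step (x) of the proof of Cor. 3.12 (kurims `paper:url-4b091feeb646`, p. 180 l. 43 – p. 181 l. 32)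
asserts that the procession-normalized log-volumes are "invariant with respect to the indeterminacies
(Ind1), (Ind2)" — the first clause of the cell's `Obs.logvolInvariantInequality`. The group-level
propagation is LANDED (abc-iut-L6-t13, `Thm311MultiradProofs`): `MRData.adm_iff_and_logvol_eq_of_mem_closure`
— if each generating (Ind1)/(Ind2) family preserves admissibility (an `↔`) and the log-volume on
admissible regions (`MRData.LogvolInvariant`), then so does EVERY element of the generated subgroup
`Subgroup.closure (Ind1Family ∪ Ind2Family)` = c312-7's `Setting.indGroup`. THIS file applies that landed
propagation to the VERBATIM SETTING of Cor. 3.12 and assembles c312-6's bridge hypotheses from it — no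
closure induction is re-proved:

* `adm_possibleImage` / `logvol_possibleImage_eq` — every POSSIBLE IMAGE of the Θ-pilot object (a
  `Setting.indGroup`-translate of the (Ind3)-enlarged region `thetaRegion3`) is admissible and has EXACTLY
  the log-volume of `thetaRegion3`: the kernel form of Step (x)'s invariance clause, on the nouns of the
  printed statement (TEAM A row A-1: citation target for the real reading of that observation).
* `bridgeHyps_of_generators` — the two fields of `Cor312Vol.BridgeHyps` that quantify over the whole
  (uncountable) group (`image_adm`, `image_fin`) REDUCE to: the generator-level hypotheses plus data about
  the ONE region `thetaRegion3` (admissible at the labels of `𝔽_l^⋇`, per-label finitely supported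
  log-volume — [IUTchIII] Prop. 3.9 (iii) — and nonempty). Feeds TEAM A row A-0 (the real-container
  discharge of the generator-level hypotheses is c312-5's A-0 / c312-d1 `HaarTransport` p405779 / c312-5
  `Thm311RealLattice` p407207; this file stays instance-free).
* `statement_of_generators` — the TEAM B assembly so far: generator-level invariance + `thetaRegion3`
  data + the Corollary's own finiteness clause (`ThetaFinite`) + admissible Kummer images
  (`ThetaRegionsAdm`, row B-3) + **VOLUME TRANSPORT** (the B-INPUT of row B-1, Step (xi-g)) ⟹ the
  printed `Statement`. Every hypothesis is named and generator-level; nothing is asserted.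

Sources read on the page: [IUTchIII] p. 156 (Thm. 3.11 (ii)), pp. 180–181 (Step (x)); Dupuy–Hilado
arXiv:2004.13228 §4 intro, §4.7 ("This map … fixes the lattice").
[claim: Mochizuki2012, status: disputed] [cite: DupuyHilado2025, §4]
Deliberately NOT here: the closure induction (LANDED, L6-t13 `Thm311MultiradProofs`), the real-instance
discharges (c312-5 A-0; c312-d1), the (Ind3) bound itself (row B-3), any judgement.
-/

noncomputable section

namespace Summit.ABC

namespace IUTFork

namespace Cor312Vol

open Thm311 Cor312 Literature.IUT.LogThetaLattice

variable {T : ThetaIndex} {S : Situation T} {P : Cor312.Setting S}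

/-! ## 1. The possible images under the landed group-level propagation -/

/-- **Every possible image of the Θ-pilot object is admissible**, given: the (Ind1)/(Ind2) families
preserve admissibility (an `↔`, as in L6-t13's landed propagation — the inverse case needs both
directions), and the (Ind3)-enlarged region is admissible. PROVED over L6-t13's
`MRData.adm_iff_and_logvol_eq_of_mem_closure` (no new induction). [folklore] -/
theorem adm_possibleImage
    (hAdm : ∀ Φ ∈ S.L.Ind1Family ∪ S.L.Ind2Family, ∀ (j : T.Label) (vQ : T.VQ)
      (A : Set (S.L.Packet j vQ)), (S.D P.n).Adm j vQ A ↔ (S.D P.n).Adm j vQ (Φ j vQ '' A))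
    (hvol : (S.D P.n).LogvolInvariant) {j : T.Label} {vQ : T.VQ}
    (h3 : (S.D P.n).Adm j vQ (P.thetaRegion3 j vQ)) {U : Set (S.L.Packet j vQ)}
    (hU : U ∈ P.possibleImages j vQ) : (S.D P.n).Adm j vQ U := by
  obtain ⟨Φ, hΦ, rfl⟩ := hU
  exact ((MRData.adm_iff_and_logvol_eq_of_mem_closure (S.D P.n) hAdm hvol hΦ j vQ
    (P.thetaRegion3 j vQ)).1).mp h3

/-- **Step (x), first clause of `Obs.logvolInvariantInequality`, kernel form on the statement's nouns**
(p. 180 l. 47–49: the procession-normalized log-volumes are "invariant with respect to the indeterminacies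
(Ind1), (Ind2)"): every possible image of the Θ-pilot object has EXACTLY the log-volume of the
(Ind3)-enlarged region. PROVED over L6-t13's landed propagation. (TEAM A row A-1: citation target for the
real reading of that observation.) [folklore] -/
theorem logvol_possibleImage_eq
    (hAdm : ∀ Φ ∈ S.L.Ind1Family ∪ S.L.Ind2Family, ∀ (j : T.Label) (vQ : T.VQ)
      (A : Set (S.L.Packet j vQ)), (S.D P.n).Adm j vQ A ↔ (S.D P.n).Adm j vQ (Φ j vQ '' A))
    (hvol : (S.D P.n).LogvolInvariant) {j : T.Label} {vQ : T.VQ}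
    (h3 : (S.D P.n).Adm j vQ (P.thetaRegion3 j vQ)) {U : Set (S.L.Packet j vQ)}
    (hU : U ∈ P.possibleImages j vQ) :
    (S.D P.n).logvol j vQ U = (S.D P.n).logvol j vQ (P.thetaRegion3 j vQ) := by
  obtain ⟨Φ, hΦ, rfl⟩ := hU
  exact (MRData.adm_iff_and_logvol_eq_of_mem_closure (S.D P.n) hAdm hvol hΦ j vQ
    (P.thetaRegion3 j vQ)).2 h3

/-! ## 2. The bridge hypotheses from generator-level data -/

variable (P) in
/-- **`BridgeHyps` from generator-level data**: the two fields of c312-6's bridge hypotheses that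
quantify over every possible image (`image_adm`, `image_fin`) reduce, by §1, to generator-level
invariance plus data about the ONE region `thetaRegion3` (admissible at the labels of `𝔽_l^⋇`, per-label
finitely supported log-volume — [IUTchIII] Prop. 3.9 (iii) — and nonempty). PROVED; feeds TEAM A row A-0.
[folklore] -/
theorem bridgeHyps_of_generators (hmono : LogvolMono P)
    (hAdm : ∀ Φ ∈ S.L.Ind1Family ∪ S.L.Ind2Family, ∀ (j : T.Label) (vQ : T.VQ)
      (A : Set (S.L.Packet j vQ)), (S.D P.n).Adm j vQ A ↔ (S.D P.n).Adm j vQ (Φ j vQ '' A))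
    (hvol : (S.D P.n).LogvolInvariant)
    (h3adm : ∀ (i : Fin T.lstar) (vQ : T.VQ),
      (S.D P.n).Adm (Setting.labelSucc i) vQ (P.thetaRegion3 (Setting.labelSucc i) vQ))
    (h3fin : ∀ i : Fin T.lstar, (Function.support fun vQ =>
      (S.D P.n).logvol (Setting.labelSucc i) vQ (P.thetaRegion3 (Setting.labelSucc i) vQ)).Finite)
    (hulne : ∀ (j : T.Label) (vQ : T.VQ), ∀ H ∈ (P.frame j vQ).Hul, H.Nonempty)
    (h3ne : ∀ (i : Fin T.lstar) (vQ : T.VQ), (P.thetaRegion3 (Setting.labelSucc i) vQ).Nonempty)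
    (hfin : P.ThetaFinite) : BridgeHyps P where
  mono := hmono
  image_adm := fun i vQ _ hU => adm_possibleImage hAdm hvol (h3adm i vQ) hU
  image_fin := fun U => by
    have heq : (fun t : Fin T.lstar × T.VQ =>
        (1 / (T.lstar : ℝ)) * (S.D P.n).logvol (Setting.labelSucc t.1) t.2 (U.1 t)) = fun t =>
        (1 / (T.lstar : ℝ)) *
          (S.D P.n).logvol (Setting.labelSucc t.1) t.2
            (P.thetaRegion3 (Setting.labelSucc t.1) t.2) := by
      funext t
      rw [logvol_possibleImage_eq hAdm hvol (h3adm t.1 t.2) (U.2 t)]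
    rw [heq]
    exact support_finite_of_labels _ h3fin
  hul_nonempty := hulne
  theta_nonempty := h3ne
  finite := hfin

variable (P) in
/-- **TEAM B ASSEMBLY (so far)**: generator-level (Ind1)/(Ind2) invariance (admissibility `↔` +
`MRData.LogvolInvariant`) + data on the (Ind3)-region (`thetaRegion3` admissible, finitely supported,
nonempty; hull-sets nonempty) + the Corollary's own finiteness clause (`ThetaFinite`) + admissible Kummer
images (`ThetaRegionsAdm`, row B-3) + **VOLUME TRANSPORT** (the B-INPUT of row B-1, Step (xi-g)) ⟹ the
printed `Statement` of Cor. 3.12. Every hypothesis is named, generator-level, and quantifier-minimal;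
which of them follow from the typed Thm. 3.11 + the frozen FACT LIST is the team's adjudication ledger;
nothing is asserted here. [claim: Mochizuki2012, status: disputed] -/
theorem statement_of_generators (hmono : LogvolMono P)
    (hAdm : ∀ Φ ∈ S.L.Ind1Family ∪ S.L.Ind2Family, ∀ (j : T.Label) (vQ : T.VQ)
      (A : Set (S.L.Packet j vQ)), (S.D P.n).Adm j vQ A ↔ (S.D P.n).Adm j vQ (Φ j vQ '' A))
    (hvol : (S.D P.n).LogvolInvariant)
    (h3adm : ∀ (i : Fin T.lstar) (vQ : T.VQ),
      (S.D P.n).Adm (Setting.labelSucc i) vQ (P.thetaRegion3 (Setting.labelSucc i) vQ))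
    (h3fin : ∀ i : Fin T.lstar, (Function.support fun vQ =>
      (S.D P.n).logvol (Setting.labelSucc i) vQ (P.thetaRegion3 (Setting.labelSucc i) vQ)).Finite)
    (hulne : ∀ (j : T.Label) (vQ : T.VQ), ∀ H ∈ (P.frame j vQ).Hul, H.Nonempty)
    (h3ne : ∀ (i : Fin T.lstar) (vQ : T.VQ), (P.thetaRegion3 (Setting.labelSucc i) vQ).Nonempty)
    (hfin : P.ThetaFinite) (hadm : ThetaRegionsAdm P) (hvt : VolumeTransport P) : P.Statement :=
  statement_of_volumeTransport P
    (bridgeHyps_of_generators P hmono hAdm hvol h3adm h3fin hulne h3ne hfin) hadm hvt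

/-! ## 3. Non-vacuity on the nonempty toy -/

namespace Checks

open Cor312.Checks

/-- The generator-level admissibility hypothesis holds on c312-6's nonempty toy (everything is
admissible). [folklore] -/
theorem adm_iff_toySettingNE :
    ∀ Φ ∈ (toySituation 0).L.Ind1Family ∪ (toySituation 0).L.Ind2Family,
      ∀ (j : toyIndex.Label) (vQ : toyIndex.VQ) (A : Set ((toySituation 0).L.Packet j vQ)),
        ((toySituation 0).D toySettingNE.n).Adm j vQ A ↔
          ((toySituation 0).D toySettingNE.n).Adm j vQ (Φ j vQ '' A) :=
  fun _ _ _ _ _ => Iff.rfl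

/-- … and the volume half (all log-volumes of `toyData 0` agree). [folklore] -/
theorem logvolInvariant_toySettingNE : ((toySituation 0).D toySettingNE.n).LogvolInvariant := by
  intro Ψ _ j vQ A _
  show (toyData 0).logvol j vQ (Ψ j vQ '' A) = (toyData 0).logvol j vQ A
  unfold toyData
  simp only
  split_ifs <;> rfl

/-- The generator-level assembly runs end to end on the toy: the bridge hypotheses assemble from the
generator-level data. [folklore] -/
example : BridgeHyps toySettingNE :=
  bridgeHyps_of_generators toySettingNE bridgeHyps_toySettingNE.mono adm_iff_toySettingNE
    logvolInvariant_toySettingNE (fun _ _ => trivial) (fun _ => Set.toFinite _)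
    bridgeHyps_toySettingNE.hul_nonempty bridgeHyps_toySettingNE.theta_nonempty
    bridgeHyps_toySettingNE.finite

end Checks

end Cor312Vol

end IUTFork

end Summit.ABC

end
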